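import Summits.BirchSwinnertonDyer.BirchSwinnertonDyer.Theses.PrintCf2RubinValueTwo
import Summits.BirchSwinnertonDyer.BirchSwinnertonDyer.Theorems.PrintCf2SplitBadTwoKatzFrameUniquenessAtTwo
import Summits.BirchSwinnertonDyer.BirchSwinnertonDyer.Theorems.PrintCf2RubinValueTwoRubinValueFormulaAtTwoUniqueTransport
import Literature.NumberTheory.EllipticCurves.Disegni2020.PAdicBSDRankOneMultiplicativeProofs
import HarnessLib

/-!
# Route `PrintCf2RubinValueTwo`, crux `RubinValueFormulaAtTwo` (stmt-BirchSwinnertonDyer-23721, S2′ of road α) — the KERNEL of line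
# `value-transport` as tree theorems: frame uniqueness at `p = 2` on every S2′ frame from the seed supply, and the crux BY NAME from
# (seed supply ∧ research kernel) and, uniqueness-free, from the ∀-form of the research kernel

Cell `bsd-print-cf2`, LEAD seat `cruxlead-23721` g0 (prover-cruxlead-stmt-BirchSwinnertonDyer-23721-g0-0); `--supports
stmt-BirchSwinnertonDyer-23721`. HONEST FRAMING: CONDITIONAL compositions — the hypotheses `hSeed` (brick B18s, the seed supply,
registered stub `stub_frameSeed_two`) and `hR` / `h` (the research kernel R = Rubin's `𝔭`-adic value formula at the additive split
prime 2, registered stub `stub_katzRubinValue_two`; beyond print) are DISPLAYED, not proved; nothing here closes the item; BSD is not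
proved by any of this; no summit statement is proved by this seat. THEOREMS ONLY (no `def`, no named fact, no `sorry`).

What IS proved here (the line's kernel, `Cruxes/RubinValueFormulaAtTwo/Lines/value_transport.lean` v2):
* `frameUnique_two_of_seed` — U_S2′: on every v10 frame of the crux two solutions of de Shalit's frame
  `IsKatzMeasure₂ ι v v̄ Sθ κ₁ κ₂ γ₁⁻¹ γ₂⁻¹ θK⁻¹ Ω δ Ωp` COINCIDE, granted a seed `(η, e, a, b)` for the frame — by brick B18
  (`PrintCf2.Bricks.stub_isKatzMeasure₂_unique_two`, -w5 g4, p680279) at the twisted branch `θK⁻¹η` and the NEGATED pair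
  `(−κ₁, −κ₂; γ₁⁻¹, γ₂⁻¹)`, transported back by B18t (`KatzUniqueTransport.isKatzMeasure₂_unique_inv_of_seed`, p683009), with `ψ`
  (type `(1,0)`) as B18's auxiliary character;
* `rubinValueFormulaAtTwo_of_seed_of_katzValue` — the crux BY NAME from the seed supply and R in EXISTENCE form (some solution of the
  frame has the Rubin value): `q = #Ш_an ∈ ℚ` by `Disegni2020.exists_rat_shaAn_eq_of_analyticRank_eq_one` (Gross–Zagier I.(7.3)),
  `G₂ = G₀` by U_S2′, `val = val₀` by `IntSeries.HasValueAt₂.unique`, `m` by `Real.rpow_right_inj`;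
* `rubinValueFormulaAtTwo_of_katzValueForall` — the crux BY NAME from R in ∀-form ALONE (uniqueness is consumed only to pass from the
  existence form to the ∀-form).
presearch: R is beyond print — [corpus: paper:doi-10-2140-pjm-2012-260-261 p.2] Bertolini–Darmon–Prasanna 2012 Thm 1 (= Rubin 1992
Cor. 10.3): `L_p(ν_A*) = Ω_p(A)⁻¹ log_ω(P)² mod ℚ×` for `p` split AND `p ∤ N_A`; their Thm 2 also needs `D` odd, `w_ν = −1`, `p ∤ N`;
[corpus: paper:doi-10-1017-s147474802300021x] Burungale–Kobayashi–Ota 2023 (inert `p`); here `2 | N` (additive). Nothing filed.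

References: [Rubin1992] Cor. 10.3; [deShalit1987] II.4.16 (49)–(50), II.4.17 (52)–(54); [GrossZagier1986] Thm. I.(7.3);
[BertoliniDarmonPrasanna2012PJM] Thm. 1–2.
-/

set_option autoImplicit false
set_option linter.dupNamespace false

noncomputable section

open scoped Classical
open NumberField IsDedekindDomain Field WeierstrassCurve
open Literature.NumberTheory.GaloisRepresentations Literature.NumberTheory.EllipticCurves
open Literature.NumberTheory.EllipticCurves.Rank1Residual
open Literature.NumberTheory.EllipticCurves.DeShalit1987
open Summit.BirchSwinnertonDyer.BirchSwinnertonDyer.Theorems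

namespace Summit.BirchSwinnertonDyer.BirchSwinnertonDyer.Theorems.PrintCf2.RubinValueFormulaKernel

/-- **U_S2′ — FRAME UNIQUENESS ON EVERY S2′ FRAME, from a seed.** For every member and v10 frame of the crux (binders of the item
VERBATIM up to the tame set), IF the frame carries a seed — a Hecke character `η` with a `2`-adic avatar `e` through the pair,
unramified away from `2`, with `θK⁻¹η` of infinity type `(−a, b)`, `b ≤ a`, unramified at every `w ∉ Sθ ∪ {v̄}` (brick B18s,
hypothesis `hSeed`) — then for all period data two solutions of de Shalit's frame for `θK⁻¹` at the inverse generators coincide.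
Proof: B18t at the negated pair + B18 at the twisted branch with auxiliary character `ψ`. [cite: deShalit1987, II.4.16 (49)–(50), II.4.17 (52)–(54)] -/
theorem frameUnique_two_of_seed
    (hSeed :
      ∀ (d : ℤ), d ≠ 0 → Squarefree d → d % 4 ≠ 1 →
      ∀ (W : WeierstrassCurve ℚ) [W.IsElliptic] [W.IsGloballyMinimal] (C : VariableChange ℚ),
      C • W = cm7.quadraticTwist (d : ℚ) → W.analyticRank = 1 →
      ∀ (K : Type) [Field K] [NumberField K], IsImaginaryQuadratic K →
      ∀ (v vbar : HeightOneSpectrum (𝓞 K)),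
      ((2 : ℕ) : 𝓞 K) ∈ v.asIdeal → ((2 : ℕ) : 𝓞 K) ∈ vbar.asIdeal → vbar ≠ v →
      ∀ (ι : PadicAlgCl 2 ≃+* ℂ),
      (∀ (w : InfinitePlace K) (k : 𝓞 K), k ∈ v.asIdeal ↔ ‖ι.symm (w.embedding (k : K))‖ < 1) →
      ∀ (c : K ≃ₐ[ℚ] K), c ≠ 1 →
      ∀ (ψ : HeckeCharacter K), ψ.HasInfinityType (fun _ ↦ 1) (fun _ ↦ 0) →
      (∀ s : ℂ, 3 / 2 < s.re → heckeLFunction ψ s = W.LSeries s) →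
      ∀ (κ₁ κ₂ : ZpExtension K 2) (γ₁ γ₂ : absoluteGaloisGroup K), ZpExtension.IsTopGeneratorPair κ₁ κ₂ γ₁ γ₂ →
      ∀ (θK ρ : HeckeCharacter K) (r : FramedGaloisRep K (PadicAlgCl 2) 1),
      θK * θK = 1 → IsPAdicAvatarOf ι ρ r → FactorsThroughPair κ₁ κ₂ r →
      θK⁻¹ * ρ = (HeckeCharacter.galConj c ψ)⁻¹ →
      ∀ (Sθ : Finset (HeightOneSpectrum (𝓞 K))), v ∉ Sθ → vbar ∉ Sθ →
      (∀ w ∈ Sθ, ¬ θK.IsUnramifiedAt w) →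
      (∀ w : HeightOneSpectrum (𝓞 K), w ∉ Sθ → w ≠ v → w ≠ vbar → θK.IsUnramifiedAt w) →
      ∃ (η : HeckeCharacter K) (e : FramedGaloisRep K (PadicAlgCl 2) 1) (a b : ℕ),
      IsPAdicAvatarOf ι η e ∧ FactorsThroughPair κ₁ κ₂ e ∧
      (∀ w : HeightOneSpectrum (𝓞 K), ((2 : ℕ) : 𝓞 K) ∉ w.asIdeal → η.IsUnramifiedAt w) ∧
      b ≤ a ∧ (θK⁻¹ * η).HasInfinityType (fun _ ↦ -(a : ℤ)) (fun _ ↦ (b : ℤ)) ∧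
      ∀ w : HeightOneSpectrum (𝓞 K), w ∉ Sθ → w ≠ vbar → (θK⁻¹ * η).IsUnramifiedAt w) :
    ∀ (d : ℤ), d ≠ 0 → Squarefree d → d % 4 ≠ 1 →
    ∀ (W : WeierstrassCurve ℚ) [W.IsElliptic] [W.IsGloballyMinimal] (C : VariableChange ℚ),
    C • W = cm7.quadraticTwist (d : ℚ) → W.analyticRank = 1 →
    ∀ (K : Type) [Field K] [NumberField K], IsImaginaryQuadratic K →
    ∀ (v vbar : HeightOneSpectrum (𝓞 K)),
    ((2 : ℕ) : 𝓞 K) ∈ v.asIdeal → ((2 : ℕ) : 𝓞 K) ∈ vbar.asIdeal → vbar ≠ v →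
    ∀ (ι : PadicAlgCl 2 ≃+* ℂ),
    (∀ (w : InfinitePlace K) (k : 𝓞 K), k ∈ v.asIdeal ↔ ‖ι.symm (w.embedding (k : K))‖ < 1) →
    ∀ (c : K ≃ₐ[ℚ] K), c ≠ 1 →
    ∀ (ψ : HeckeCharacter K), ψ.HasInfinityType (fun _ ↦ 1) (fun _ ↦ 0) →
    (∀ s : ℂ, 3 / 2 < s.re → heckeLFunction ψ s = W.LSeries s) →
    ∀ (κ₁ κ₂ : ZpExtension K 2) (γ₁ γ₂ : absoluteGaloisGroup K), ZpExtension.IsTopGeneratorPair κ₁ κ₂ γ₁ γ₂ →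
    ∀ (θK ρ : HeckeCharacter K) (r : FramedGaloisRep K (PadicAlgCl 2) 1),
    θK * θK = 1 → IsPAdicAvatarOf ι ρ r → FactorsThroughPair κ₁ κ₂ r →
    θK⁻¹ * ρ = (HeckeCharacter.galConj c ψ)⁻¹ →
    ∀ (Sθ : Finset (HeightOneSpectrum (𝓞 K))), v ∉ Sθ → vbar ∉ Sθ →
    (∀ w ∈ Sθ, ¬ θK.IsUnramifiedAt w) →
    (∀ w : HeightOneSpectrum (𝓞 K), w ∉ Sθ → w ≠ v → w ≠ vbar → θK.IsUnramifiedAt w) →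
    ∀ (Ω δ : ℂ) (Ωp : ℂ_[2]) (G G' : PowerSeries (PowerSeries (PadicComplexInt 2))),
    IsKatzMeasure₂ ι v vbar Sθ κ₁ κ₂ γ₁⁻¹ γ₂⁻¹ θK⁻¹ Ω δ Ωp G →
    IsKatzMeasure₂ ι v vbar Sθ κ₁ κ₂ γ₁⁻¹ γ₂⁻¹ θK⁻¹ Ω δ Ωp G' → G = G' := by
  intro d hd0 hsq hd4 W _ _ C hC hr K _ _ hK v vbar hv hvbar hne ι hι c hc ψ hψ hL κ₁ κ₂ γ₁ γ₂ hpair θK ρ r hθK hρr hrpair hρ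
    Sθ hvS hvbarS hSram hSunr Ω δ Ωp G G' hG hG'
  obtain ⟨η, e, a, b, he, heκ, hηu, hba, htype, hunr⟩ :=
    hSeed d hd0 hsq hd4 W C hC hr K hK v vbar hv hvbar hne ι hι c hc ψ hψ hL κ₁ κ₂ γ₁ γ₂ hpair θK ρ r hθK hρr hrpair hρ
      Sθ hvS hvbarS hSram hSunr
  exact KatzUniqueTransport.isKatzMeasure₂_unique_inv_of_seed hpair he heκ hηu
    (fun κ₁' κ₂' hpair' H H' hH hH' ↦
      PrintCf2.Bricks.stub_isKatzMeasure₂_unique_two hK hv hvbar hne hι one_pos (by simpa using hψ) hba htype hunr hpair' hH hH')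
    hG hG'

/-- **THE CRUX BY NAME from the seed supply (B18s) and the research kernel R in existence form** — the composition of line
`value-transport` with its two closed bricks (B18, B18t) inlined: given the frame, `q := #Ш_an(W) ∈ ℚ` (Gross–Zagier I.(7.3) rationality,
tree), R supplies a solution `G₀` of the same frame with a value `val₀` of norm `2^{−M/2}`, U_S2′ gives `G₂ = G₀`, the value at a point is
unique, hence `2^{−m/2} = 2^{−M/2}` and `m = M`. CONDITIONAL on the displayed `hSeed`, `hR` (registered stubs `stub_frameSeed_two`,
`stub_katzRubinValue_two`). [cite: Rubin1992, Cor. 10.3 (shape)] [cite: GrossZagier1986, Thm. I.(7.3) 2)] -/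
theorem rubinValueFormulaAtTwo_of_seed_of_katzValue
    (hSeed :
      ∀ (d : ℤ), d ≠ 0 → Squarefree d → d % 4 ≠ 1 →
      ∀ (W : WeierstrassCurve ℚ) [W.IsElliptic] [W.IsGloballyMinimal] (C : VariableChange ℚ),
      C • W = cm7.quadraticTwist (d : ℚ) → W.analyticRank = 1 →
      ∀ (K : Type) [Field K] [NumberField K], IsImaginaryQuadratic K →
      ∀ (v vbar : HeightOneSpectrum (𝓞 K)),
      ((2 : ℕ) : 𝓞 K) ∈ v.asIdeal → ((2 : ℕ) : 𝓞 K) ∈ vbar.asIdeal → vbar ≠ v →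
      ∀ (ι : PadicAlgCl 2 ≃+* ℂ),
      (∀ (w : InfinitePlace K) (k : 𝓞 K), k ∈ v.asIdeal ↔ ‖ι.symm (w.embedding (k : K))‖ < 1) →
      ∀ (c : K ≃ₐ[ℚ] K), c ≠ 1 →
      ∀ (ψ : HeckeCharacter K), ψ.HasInfinityType (fun _ ↦ 1) (fun _ ↦ 0) →
      (∀ s : ℂ, 3 / 2 < s.re → heckeLFunction ψ s = W.LSeries s) →
      ∀ (κ₁ κ₂ : ZpExtension K 2) (γ₁ γ₂ : absoluteGaloisGroup K), ZpExtension.IsTopGeneratorPair κ₁ κ₂ γ₁ γ₂ →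
      ∀ (θK ρ : HeckeCharacter K) (r : FramedGaloisRep K (PadicAlgCl 2) 1),
      θK * θK = 1 → IsPAdicAvatarOf ι ρ r → FactorsThroughPair κ₁ κ₂ r →
      θK⁻¹ * ρ = (HeckeCharacter.galConj c ψ)⁻¹ →
      ∀ (Sθ : Finset (HeightOneSpectrum (𝓞 K))), v ∉ Sθ → vbar ∉ Sθ →
      (∀ w ∈ Sθ, ¬ θK.IsUnramifiedAt w) →
      (∀ w : HeightOneSpectrum (𝓞 K), w ∉ Sθ → w ≠ v → w ≠ vbar → θK.IsUnramifiedAt w) →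
      ∃ (η : HeckeCharacter K) (e : FramedGaloisRep K (PadicAlgCl 2) 1) (a b : ℕ),
      IsPAdicAvatarOf ι η e ∧ FactorsThroughPair κ₁ κ₂ e ∧
      (∀ w : HeightOneSpectrum (𝓞 K), ((2 : ℕ) : 𝓞 K) ∉ w.asIdeal → η.IsUnramifiedAt w) ∧
      b ≤ a ∧ (θK⁻¹ * η).HasInfinityType (fun _ ↦ -(a : ℤ)) (fun _ ↦ (b : ℤ)) ∧
      ∀ w : HeightOneSpectrum (𝓞 K), w ∉ Sθ → w ≠ vbar → (θK⁻¹ * η).IsUnramifiedAt w)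
    (hR :
      GrossZagier1986_thm_I_7_3 → rank_eq_analyticRank_of_analyticRank_le_one →
      ∃ eA : ℤ → ℤ → ℤ,
      ∀ (d : ℤ), d ≠ 0 → Squarefree d → d % 4 ≠ 1 →
      ∀ (W : WeierstrassCurve ℚ) [W.IsElliptic] [W.IsGloballyMinimal] (C : VariableChange ℚ),
      C • W = cm7.quadraticTwist (d : ℚ) → W.analyticRank = 1 →
      ∀ (K : Type) [Field K] [NumberField K], IsImaginaryQuadratic K →
      ∀ (v vbar : HeightOneSpectrum (𝓞 K)),
      ((2 : ℕ) : 𝓞 K) ∈ v.asIdeal → ((2 : ℕ) : 𝓞 K) ∈ vbar.asIdeal → vbar ≠ v →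
      ∀ (ι : PadicAlgCl 2 ≃+* ℂ),
      (∀ (w : InfinitePlace K) (k : 𝓞 K), k ∈ v.asIdeal ↔ ‖ι.symm (w.embedding (k : K))‖ < 1) →
      ∀ (c : K ≃ₐ[ℚ] K), c ≠ 1 →
      ∀ (ψ : HeckeCharacter K), ψ.HasInfinityType (fun _ ↦ 1) (fun _ ↦ 0) →
      (∀ s : ℂ, 3 / 2 < s.re → heckeLFunction ψ s = W.LSeries s) →
      ∀ (κ₁ κ₂ : ZpExtension K 2) (γ₁ γ₂ : absoluteGaloisGroup K), ZpExtension.IsTopGeneratorPair κ₁ κ₂ γ₁ γ₂ →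
      ∀ (θK ρ : HeckeCharacter K) (r : FramedGaloisRep K (PadicAlgCl 2) 1),
      θK * θK = 1 → IsPAdicAvatarOf ι ρ r → FactorsThroughPair κ₁ κ₂ r →
      θK⁻¹ * ρ = (HeckeCharacter.galConj c ψ)⁻¹ →
      ∀ (Sθ : Finset (HeightOneSpectrum (𝓞 K))), v ∉ Sθ → vbar ∉ Sθ →
      (∀ w ∈ Sθ, ¬ θK.IsUnramifiedAt w) →
      (∀ w : HeightOneSpectrum (𝓞 K), w ∉ Sθ → w ≠ v → w ≠ vbar → θK.IsUnramifiedAt w) →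
      ∀ (Ω δ : ℂ) (Ωp : (unrIntegers 2)ˣ) (G₂ : PowerSeries (PowerSeries (PadicComplexInt 2))),
      Ω ≠ 0 → (δ ^ 2 = (NumberField.discr K : ℂ) ∨ δ ^ 2 = -(NumberField.discr K : ℂ)) →
      IsKatzMeasure₂ ι v vbar Sθ κ₁ κ₂ γ₁⁻¹ γ₂⁻¹ θK⁻¹ Ω δ ((Ωp : unrIntegers 2) : ℂ_[2]) G₂ →
      ∀ (P : W.toAffine.Point) (c₀ : ℕ) (ℓ : ℤ),
      ¬ IsOfFinAddOrder P →
      (∀ R : W.toAffine.Point, ∃ (k : ℤ) (T : W.toAffine.Point), IsOfFinAddOrder T ∧ R = k • P + T) →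
      c₀ ≠ 0 → (W.baseChange ℚ_[2]).IsInReductionKernel (c₀ • W.toPadicPoint 2 P) →
      ‖(W.baseChange ℚ_[2]).padicLogPoint (c₀ • W.toPadicPoint 2 P) / (c₀ : ℚ_[2])‖ = (2 : ℝ) ^ (-ℓ) →
      ∀ (q : ℚ), shaAn W = (q : ℂ) →
      ∃ G₀ : PowerSeries (PowerSeries (PadicComplexInt 2)),
      IsKatzMeasure₂ ι v vbar Sθ κ₁ κ₂ γ₁⁻¹ γ₂⁻¹ θK⁻¹ Ω δ ((Ωp : unrIntegers 2) : ℂ_[2]) G₀ ∧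
      ∃ val₀ : ℂ_[2],
      IntSeries.HasValueAt₂ G₀ (avatarValueAt r γ₁⁻¹ - 1) (avatarValueAt r γ₂⁻¹ - 1) val₀ ∧
      ‖val₀‖ = (2 : ℝ) ^ (-((2 * (padicValRat 2 q + (padicValNat 2 W.tamagawaProduct : ℤ)
      - 2 * (padicValNat 2 W.torsionOrder : ℤ) + 2 * ℓ) + eA (d % 2) ((d / (2 - d % 2)) % 8) : ℤ) : ℝ) / 2)) :
    Summit.BirchSwinnertonDyer.BirchSwinnertonDyer.Theses.PrintCf2RubinValueTwo.RubinValueFormulaAtTwo := by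
  intro hGZ hRk
  obtain ⟨eA, hA⟩ := hR hGZ hRk
  refine ⟨eA, ?_⟩
  intro d hd0 hsq hd4 W _ _ C hC hr K _ _ hK v vbar hv hvbar hne ι hι c hc ψ hψ hL κ₁ κ₂ γ₁ γ₂ hpair θK ρ r hθK hρr hrpair hρ
    Sθ hvS hvbarS hSram hSunr Ω δ Ωp G₂ hΩ hδ hG₂ P c₀ ℓ hP hgen hc₀ hker hlog
  obtain ⟨q, hq⟩ := Disegni2020.exists_rat_shaAn_eq_of_analyticRank_eq_one hGZ hRk W hr
  refine ⟨q, hq, fun val m hval hnorm ↦ ?_⟩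
  obtain ⟨G₀, hG₀, val₀, hval₀, hnorm₀⟩ := hA d hd0 hsq hd4 W C hC hr K hK v vbar hv hvbar hne ι hι c hc ψ hψ hL κ₁ κ₂ γ₁ γ₂
    hpair θK ρ r hθK hρr hrpair hρ Sθ hvS hvbarS hSram hSunr Ω δ Ωp G₂ hΩ hδ hG₂ P c₀ ℓ hP hgen hc₀ hker hlog q hq
  have hGG : G₂ = G₀ := frameUnique_two_of_seed hSeed d hd0 hsq hd4 W C hC hr K hK v vbar hv hvbar hne ι hι c hc ψ hψ hL κ₁ κ₂
    γ₁ γ₂ hpair θK ρ r hθK hρr hrpair hρ Sθ hvS hvbarS hSram hSunr Ω δ _ G₂ G₀ hG₂ hG₀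
  subst hGG
  have hvv : val = val₀ := hval.unique hval₀
  rw [hvv, hnorm₀] at hnorm
  have hexp := (Real.rpow_right_inj (by norm_num : (0 : ℝ) < 2) (by norm_num : (2 : ℝ) ≠ 1)).mp hnorm.symm
  have hcast : (m : ℝ) = ((2 * (padicValRat 2 q + (padicValNat 2 W.tamagawaProduct : ℤ)
      - 2 * (padicValNat 2 W.torsionOrder : ℤ) + 2 * ℓ) + eA (d % 2) ((d / (2 - d % 2)) % 8) : ℤ) : ℝ) := by
    linarith
  exact_mod_cast hcast

/-- **THE CRUX BY NAME from the research kernel in ∀-form ALONE** (no uniqueness, no seed): if EVERY solution of the frame takes the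
Rubin value at the point, the item follows by `#Ш_an ∈ ℚ` and the uniqueness of values at a point. CONDITIONAL on the displayed `h`.
[cite: Rubin1992, Cor. 10.3 (shape)] [cite: GrossZagier1986, Thm. I.(7.3) 2)] -/
theorem rubinValueFormulaAtTwo_of_katzValueForall
    (h :
      GrossZagier1986_thm_I_7_3 → rank_eq_analyticRank_of_analyticRank_le_one →
      ∃ eA : ℤ → ℤ → ℤ,
      ∀ (d : ℤ), d ≠ 0 → Squarefree d → d % 4 ≠ 1 →
      ∀ (W : WeierstrassCurve ℚ) [W.IsElliptic] [W.IsGloballyMinimal] (C : VariableChange ℚ),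
      C • W = cm7.quadraticTwist (d : ℚ) → W.analyticRank = 1 →
      ∀ (K : Type) [Field K] [NumberField K], IsImaginaryQuadratic K →
      ∀ (v vbar : HeightOneSpectrum (𝓞 K)),
      ((2 : ℕ) : 𝓞 K) ∈ v.asIdeal → ((2 : ℕ) : 𝓞 K) ∈ vbar.asIdeal → vbar ≠ v →
      ∀ (ι : PadicAlgCl 2 ≃+* ℂ),
      (∀ (w : InfinitePlace K) (k : 𝓞 K), k ∈ v.asIdeal ↔ ‖ι.symm (w.embedding (k : K))‖ < 1) →
      ∀ (c : K ≃ₐ[ℚ] K), c ≠ 1 →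
      ∀ (ψ : HeckeCharacter K), ψ.HasInfinityType (fun _ ↦ 1) (fun _ ↦ 0) →
      (∀ s : ℂ, 3 / 2 < s.re → heckeLFunction ψ s = W.LSeries s) →
      ∀ (κ₁ κ₂ : ZpExtension K 2) (γ₁ γ₂ : absoluteGaloisGroup K), ZpExtension.IsTopGeneratorPair κ₁ κ₂ γ₁ γ₂ →
      ∀ (θK ρ : HeckeCharacter K) (r : FramedGaloisRep K (PadicAlgCl 2) 1),
      θK * θK = 1 → IsPAdicAvatarOf ι ρ r → FactorsThroughPair κ₁ κ₂ r →
      θK⁻¹ * ρ = (HeckeCharacter.galConj c ψ)⁻¹ →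
      ∀ (Sθ : Finset (HeightOneSpectrum (𝓞 K))), v ∉ Sθ → vbar ∉ Sθ →
      (∀ w ∈ Sθ, ¬ θK.IsUnramifiedAt w) →
      (∀ w : HeightOneSpectrum (𝓞 K), w ∉ Sθ → w ≠ v → w ≠ vbar → θK.IsUnramifiedAt w) →
      ∀ (Ω δ : ℂ) (Ωp : (unrIntegers 2)ˣ) (G₂ : PowerSeries (PowerSeries (PadicComplexInt 2))),
      Ω ≠ 0 → (δ ^ 2 = (NumberField.discr K : ℂ) ∨ δ ^ 2 = -(NumberField.discr K : ℂ)) →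
      IsKatzMeasure₂ ι v vbar Sθ κ₁ κ₂ γ₁⁻¹ γ₂⁻¹ θK⁻¹ Ω δ ((Ωp : unrIntegers 2) : ℂ_[2]) G₂ →
      ∀ (P : W.toAffine.Point) (c₀ : ℕ) (ℓ : ℤ),
      ¬ IsOfFinAddOrder P →
      (∀ R : W.toAffine.Point, ∃ (k : ℤ) (T : W.toAffine.Point), IsOfFinAddOrder T ∧ R = k • P + T) →
      c₀ ≠ 0 → (W.baseChange ℚ_[2]).IsInReductionKernel (c₀ • W.toPadicPoint 2 P) →
      ‖(W.baseChange ℚ_[2]).padicLogPoint (c₀ • W.toPadicPoint 2 P) / (c₀ : ℚ_[2])‖ = (2 : ℝ) ^ (-ℓ) →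
      ∀ (q : ℚ), shaAn W = (q : ℂ) →
      ∃ val₀ : ℂ_[2],
      IntSeries.HasValueAt₂ G₂ (avatarValueAt r γ₁⁻¹ - 1) (avatarValueAt r γ₂⁻¹ - 1) val₀ ∧
      ‖val₀‖ = (2 : ℝ) ^ (-((2 * (padicValRat 2 q + (padicValNat 2 W.tamagawaProduct : ℤ)
      - 2 * (padicValNat 2 W.torsionOrder : ℤ) + 2 * ℓ) + eA (d % 2) ((d / (2 - d % 2)) % 8) : ℤ) : ℝ) / 2)) :
    Summit.BirchSwinnertonDyer.BirchSwinnertonDyer.Theses.PrintCf2RubinValueTwo.RubinValueFormulaAtTwo := by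
  intro hGZ hRk
  obtain ⟨eA, hA⟩ := h hGZ hRk
  refine ⟨eA, ?_⟩
  intro d hd0 hsq hd4 W _ _ C hC hr K _ _ hK v vbar hv hvbar hne ι hι c hc ψ hψ hL κ₁ κ₂ γ₁ γ₂ hpair θK ρ r hθK hρr hrpair hρ
    Sθ hvS hvbarS hSram hSunr Ω δ Ωp G₂ hΩ hδ hG₂ P c₀ ℓ hP hgen hc₀ hker hlog
  obtain ⟨q, hq⟩ := Disegni2020.exists_rat_shaAn_eq_of_analyticRank_eq_one hGZ hRk W hr
  refine ⟨q, hq, fun val m hval hnorm ↦ ?_⟩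
  obtain ⟨val₀, hval₀, hnorm₀⟩ := hA d hd0 hsq hd4 W C hC hr K hK v vbar hv hvbar hne ι hι c hc ψ hψ hL κ₁ κ₂ γ₁ γ₂
    hpair θK ρ r hθK hρr hrpair hρ Sθ hvS hvbarS hSram hSunr Ω δ Ωp G₂ hΩ hδ hG₂ P c₀ ℓ hP hgen hc₀ hker hlog q hq
  have hvv : val = val₀ := hval.unique hval₀
  rw [hvv, hnorm₀] at hnorm
  have hexp := (Real.rpow_right_inj (by norm_num : (0 : ℝ) < 2) (by norm_num : (2 : ℝ) ≠ 1)).mp hnorm.symm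
  have hcast : (m : ℝ) = ((2 * (padicValRat 2 q + (padicValNat 2 W.tamagawaProduct : ℤ)
      - 2 * (padicValNat 2 W.torsionOrder : ℤ) + 2 * ℓ) + eA (d % 2) ((d / (2 - d % 2)) % 8) : ℤ) : ℝ) := by
    linarith
  exact_mod_cast hcast

end Summit.BirchSwinnertonDyer.BirchSwinnertonDyer.Theorems.PrintCf2.RubinValueFormulaKernel

end
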